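import Literature.AnabelianGeometry.SemiGraphs.TemperedEscapeOfHeights
import Literature.AnabelianGeometry.SemiGraphs.TemperedPiCompactnessCriterion
import Literature.AnabelianGeometry.SemiGraphs.TemperedPiVerticialLevelData
import Literature.AnabelianGeometry.SemiGraphs.ThetaRayGraph
import HarnessLib

/-!
# The escape at the canonical chart of `𝒢_θ`, assembled from level data (REFUTE-F1732, brick R6)

Mochizuki, *Semi-graphs of anabelioids*, Publ. RIMS **42** (2006) [MochizukiSemiAnbd2006], §3,
Theorem 3.7 (iii), author's manuscript pp. 40–41 [cite: MochizukiSemiAnbd2006, Thm 3.7(iii) pp.40-41];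
the printed proof (p. 41 "since the semi-graphs `𝔾_j` are all finite") covers FINITE `𝔾` (kernel:
`compactInVerticialAt_of_finiteGraph`, p431007).  FRONTIER programme REFUTE-F1732
(plan/L3/SUBDAG-SemiAnbd-Thm37iii-REFUTE.md; honest framing α59: towards a kernel erratum for the
∀-countable reading of Thm 3.7 (iii) as amended by [IUTchI] Rmk 2.5.3; desk countermodel `𝒢_θ` of
abc-iut-L3-d1, memo COUNTERMODEL-Thm37iii-infinite.md sha16 8b26b5199c29f55f, four concurring readers).

PROOF-ONLY file (abc-iut-L3-d4, brick R6 assembly at the CANONICAL chart; 0 definitions, no named fact).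
For the ray semi-graph of anabelioids `𝒢 := thetaRay G E up low` (brick R3) satisfying the hypotheses of
Thm 3.7, with canonical chart `𝒢.temperedPiChart h36`, Galois tower `D := 𝒢.galoisLevelData h36`
(`π₁^temp = lim_j Gal(𝒢_{∞,j}/𝒢)`, trees `𝔾̃_j = D.tree j`) and level data
`verticialLevelData_temperedPiChart`, the memo's steps (2a)–(2d) are assembled from LEVEL-WISE inputs on a
sequence `z : ℕ → π₁^temp` (memo: the edge generators `z_k` of the base apartment):

* (hz)   eventual level-wise agreement `ρ_j(z_{k+1}) = ρ_j(z_k)` for `k ≥ N_j` (memo (2a); cell item (c2));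
* (hfin) every `ρ_j(z_k)` has finite order (the `z_k` lie in compact verticial subgroups);
* (hfar) `z_k` fixes at every level a tree vertex over a position `≥ k` (the apartment vertex `x̃_{k+1}`;
         (I1) `fix_temperedPiChart`; cell item (c1));
* (hcrit) for every `n`, at all deep levels `j` and all large `k`, `ρ_j(z_k)` fixes no critical sub-joint at
         a tree vertex over the position `n + 1` (memo (2c): `SemiGraph.ray_not_critical_of_characters`,
         p437320, from the level character, the Bass–Serre local structure and the abelianisation),

the limit `c := lim z_k` (abc-iut-w4-d071's `exists_forall_eventually_projAut_eq`) generates a COMPACT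
procyclic `C := closure⟨c⟩ ≠ ⊥` (`isCompact_topologicalClosure_zpowers`) whose fixed loci escape
(`VerticialLevelData.height_unbounded_of_criticalFree`, p437307), so `CompactInVerticialAt 𝒢` FAILS at the
canonical chart (`thetaRay_not_compactInVerticialAt_of_levelEscape`; ∘ abc-iut-L3-t5 p435110 ∘ abc-iut-L3-t6
p432161) and with it the ∀-countable `CompactInVerticial.{0}`.  NEGATIVE-MODULO form: the inputs are
binders; bricks R1/R4/R5 and the level dictionary supply them at `G = F̂_p⟨a,b⟩`.  Nothing here bears on
[IUTchIII] Cor. 3.12 (IUT uses finite dual semi-graphs only).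
-/

namespace Literature.AnabelianGeometry.SemiGraphs

open CategoryTheory Topology

/-- On the ray, the two end-vertices of an edge have positions differing by exactly one.
[cite: MochizukiSemiAnbd2006, §1 p.11] -/
theorem SemiGraph.ray_heightStep : ∀ (b₁ b₂ : SemiGraph.ray.Branch) (v₁ v₂ : SemiGraph.ray.Vertex),
    b₁ ≠ b₂ → SemiGraph.ray.edgeOf b₁ = SemiGraph.ray.edgeOf b₂ → SemiGraph.ray.abuts b₁ = some v₁ →
    SemiGraph.ray.abuts b₂ = some v₂ → v₁ + 1 = v₂ ∨ v₂ + 1 = v₁ := by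
  rintro ⟨m₁, s₁⟩ ⟨m₂, s₂⟩ v₁ v₂ hne he h₁ h₂
  have hm : m₁ = m₂ := he
  subst hm
  have e₁ : (if s₁ then m₁ + 1 else m₁) = v₁ := Option.some.inj h₁
  have e₂ : (if s₂ then m₁ + 1 else m₁) = v₂ := Option.some.inj h₂
  cases s₁ <;> cases s₂ <;> simp only [Bool.false_eq_true, ↓reduceIte] at e₁ e₂
  · exact absurd rfl hne
  · subst e₁ e₂; exact Or.inl rfl
  · subst e₁ e₂; exact Or.inr rfl
  · exact absurd rfl hne

namespace ProfiniteSemiGraph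

section ThetaRayEscape

variable {G E : Type} [Group G] [TopologicalSpace G] [IsTopologicalGroup G] [CompactSpace G]
  [TotallyDisconnectedSpace G] [Group E] [TopologicalSpace E] [IsTopologicalGroup E] [CompactSpace E]
  [TotallyDisconnectedSpace E] {up : E →ₜ* G} {low : ℕ → (E →ₜ* G)}

/-- **R6 assembly: the escape at the canonical chart from level data** (memo (2a)–(2d) over binders; see
the module docstring).  Conclusion: `CompactInVerticialAt (thetaRay G E up low)` is FALSE.
[cite: MochizukiSemiAnbd2006, Thm 3.7(iii) pp.40-41] -/
theorem thetaRay_not_compactInVerticialAt_of_levelEscape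
    (h37 : (thetaRay G E up low).Thm37Hypotheses)
    (z : ℕ → (thetaRay G E up low).temperedPi h37.toProp36Hypotheses)
    (hz : ∀ j : ℕ, ∃ N : ℕ, ∀ k, N ≤ k →
      ((thetaRay G E up low).galoisLevelData h37.toProp36Hypotheses).proj h37.isCountable j (z (k + 1)) =
        ((thetaRay G E up low).galoisLevelData h37.toProp36Hypotheses).proj h37.isCountable j (z k))
    (hfin : ∀ j k : ℕ, IsOfFinOrder
      (((thetaRay G E up low).galoisLevelData h37.toProp36Hypotheses).proj h37.isCountable j (z k)))
    (hfar : ∀ k j : ℕ, ∃ x : (((thetaRay G E up low).galoisLevelData h37.toProp36Hypotheses).tree j).Vertex,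
      k ≤ (((thetaRay G E up low).galoisLevelData h37.toProp36Hypotheses).treeProj j).vertexMap x ∧
        (((thetaRay G E up low).galoisLevelData h37.toProp36Hypotheses).treeAct h37.isCountable j
          (z k)).hom.vertexMap x = x)
    (hcrit : ∀ n : ℕ, ∃ j₀ : ℕ, ∀ j, j₀ ≤ j → ∃ N : ℕ, ∀ k, N ≤ k →
      ∀ (y : (((thetaRay G E up low).galoisLevelData h37.toProp36Hypotheses).tree j).Vertex)
        (b b' : (((thetaRay G E up low).galoisLevelData h37.toProp36Hypotheses).tree j).Branch),
        (((thetaRay G E up low).galoisLevelData h37.toProp36Hypotheses).tree j).abuts b = some y →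
        (((thetaRay G E up low).galoisLevelData h37.toProp36Hypotheses).tree j).abuts b' = some y →
        (((thetaRay G E up low).galoisLevelData h37.toProp36Hypotheses).treeProj j).vertexMap y = n + 1 →
        (((thetaRay G E up low).galoisLevelData h37.toProp36Hypotheses).treeAct h37.isCountable j
            (z k)).hom.edgeMap
          ((((thetaRay G E up low).galoisLevelData h37.toProp36Hypotheses).tree j).edgeOf b) =
          (((thetaRay G E up low).galoisLevelData h37.toProp36Hypotheses).tree j).edgeOf b →
        (((thetaRay G E up low).galoisLevelData h37.toProp36Hypotheses).treeAct h37.isCountable j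
            (z k)).hom.edgeMap
          ((((thetaRay G E up low).galoisLevelData h37.toProp36Hypotheses).tree j).edgeOf b') =
          (((thetaRay G E up low).galoisLevelData h37.toProp36Hypotheses).tree j).edgeOf b' →
        (∃ (b₂ : (((thetaRay G E up low).galoisLevelData h37.toProp36Hypotheses).tree j).Branch)
           (v₂ : (((thetaRay G E up low).galoisLevelData h37.toProp36Hypotheses).tree j).Vertex), b₂ ≠ b ∧
          (((thetaRay G E up low).galoisLevelData h37.toProp36Hypotheses).tree j).edgeOf b₂ =
            (((thetaRay G E up low).galoisLevelData h37.toProp36Hypotheses).tree j).edgeOf b ∧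
          (((thetaRay G E up low).galoisLevelData h37.toProp36Hypotheses).tree j).abuts b₂ = some v₂ ∧
          (((thetaRay G E up low).galoisLevelData h37.toProp36Hypotheses).treeProj j).vertexMap v₂ =
            n + 2) →
        (∃ (b₂ : (((thetaRay G E up low).galoisLevelData h37.toProp36Hypotheses).tree j).Branch)
           (v₂ : (((thetaRay G E up low).galoisLevelData h37.toProp36Hypotheses).tree j).Vertex), b₂ ≠ b' ∧
          (((thetaRay G E up low).galoisLevelData h37.toProp36Hypotheses).tree j).edgeOf b₂ =
            (((thetaRay G E up low).galoisLevelData h37.toProp36Hypotheses).tree j).edgeOf b' ∧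
          (((thetaRay G E up low).galoisLevelData h37.toProp36Hypotheses).tree j).abuts b₂ = some v₂ ∧
          (((thetaRay G E up low).galoisLevelData h37.toProp36Hypotheses).treeProj j).vertexMap v₂ = n) →
        False) :
    ¬ CompactInVerticialAt (thetaRay G E up low) := by
  -- abbreviations
  set 𝒢 : ProfiniteSemiGraph.{0} := thetaRay G E up low
  have h36 : 𝒢.Prop36Hypotheses := h37.toProp36Hypotheses
  set D : GaloisLevelData 𝒢 := 𝒢.galoisLevelData h36
  -- (2a) the limit `c := lim z_k`
  obtain ⟨c, hc⟩ := D.exists_forall_eventually_projAut_eq h36.isCountable z hz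
  choose N hN using hc
  -- (2b) `C := closure⟨c⟩` is compact and non-trivial
  have hford : ∀ j, IsOfFinOrder (D.projAut h36.isCountable j c) := fun j => by
    rw [hN j (N j) le_rfl]; exact hfin j (N j)
  have hC : IsCompact ((Subgroup.zpowers c).topologicalClosure : Set (D.temperedPi h36.isCountable)) :=
    D.isCompact_topologicalClosure_zpowers h36.isCountable c hford
  have hcC : c ∈ (Subgroup.zpowers c).topologicalClosure :=
    Subgroup.le_topologicalClosure _ (Subgroup.mem_zpowers c)
  -- the action of `c` at level `j` is that of `z_k`, `k ≥ N j`
  have hact : ∀ j k, N j ≤ k →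
      D.treeAct h36.isCountable j c = D.treeAct h36.isCountable j (z k) := fun j k hk => by
    rw [D.treeAct_apply h36.isCountable, D.treeAct_apply h36.isCountable]
    exact congrArg _ (hN j k hk)
  -- (2c)/(2d) escape at the canonical level data
  refine (verticialLevelData_temperedPiChart (h36 := h36)).not_compactInVerticialAt_of_criticalFree h37
    (fun v : ℕ => v) SemiGraph.ray_heightStep ((Subgroup.zpowers c).topologicalClosure) hC c hcC ?_ ?_
  · -- hfar for `c`
    intro j n
    obtain ⟨x, hx, hfix⟩ := hfar (max n (N j)) j
    refine ⟨x, le_trans (le_max_left _ _) hx, ?_⟩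
    change (D.treeAct h36.isCountable j c).hom.vertexMap x = x
    rw [hact j (max n (N j)) (le_max_right _ _)]
    exact hfix
  · -- hcrit for `c`
    intro n
    obtain ⟨j₀, hj₀⟩ := hcrit n
    refine ⟨j₀, fun j hj y b b' hb hb' hy he he' hup hdown => ?_⟩
    obtain ⟨N', hN'⟩ := hj₀ j hj
    have hk : N' ≤ max N' (N j) := le_max_left _ _
    change (D.treeAct h36.isCountable j c).hom.edgeMap _ = _ at he
    change (D.treeAct h36.isCountable j c).hom.edgeMap _ = _ at he'
    rw [hact j (max N' (N j)) (le_max_right _ _)] at he he'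
    exact hN' _ hk y b b' hb hb' hy he he' hup hdown

/-- … hence the ∀-countable named fact `CompactInVerticial.{0}` (F-1732) is FALSE under the same level
data. NEGATIVE-MODULO form. [cite: MochizukiSemiAnbd2006, Thm 3.7(iii) pp.40-41] -/
theorem thetaRay_not_compactInVerticial_of_levelEscape
    (h37 : (thetaRay G E up low).Thm37Hypotheses)
    (z : ℕ → (thetaRay G E up low).temperedPi h37.toProp36Hypotheses)
    (hz : ∀ j : ℕ, ∃ N : ℕ, ∀ k, N ≤ k →
      ((thetaRay G E up low).galoisLevelData h37.toProp36Hypotheses).proj h37.isCountable j (z (k + 1)) =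
        ((thetaRay G E up low).galoisLevelData h37.toProp36Hypotheses).proj h37.isCountable j (z k))
    (hfin : ∀ j k : ℕ, IsOfFinOrder
      (((thetaRay G E up low).galoisLevelData h37.toProp36Hypotheses).proj h37.isCountable j (z k)))
    (hfar : ∀ k j : ℕ, ∃ x : (((thetaRay G E up low).galoisLevelData h37.toProp36Hypotheses).tree j).Vertex,
      k ≤ (((thetaRay G E up low).galoisLevelData h37.toProp36Hypotheses).treeProj j).vertexMap x ∧
        (((thetaRay G E up low).galoisLevelData h37.toProp36Hypotheses).treeAct h37.isCountable j
          (z k)).hom.vertexMap x = x)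
    (hcrit : ∀ n : ℕ, ∃ j₀ : ℕ, ∀ j, j₀ ≤ j → ∃ N : ℕ, ∀ k, N ≤ k →
      ∀ (y : (((thetaRay G E up low).galoisLevelData h37.toProp36Hypotheses).tree j).Vertex)
        (b b' : (((thetaRay G E up low).galoisLevelData h37.toProp36Hypotheses).tree j).Branch),
        (((thetaRay G E up low).galoisLevelData h37.toProp36Hypotheses).tree j).abuts b = some y →
        (((thetaRay G E up low).galoisLevelData h37.toProp36Hypotheses).tree j).abuts b' = some y →
        (((thetaRay G E up low).galoisLevelData h37.toProp36Hypotheses).treeProj j).vertexMap y = n + 1 →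
        (((thetaRay G E up low).galoisLevelData h37.toProp36Hypotheses).treeAct h37.isCountable j
            (z k)).hom.edgeMap
          ((((thetaRay G E up low).galoisLevelData h37.toProp36Hypotheses).tree j).edgeOf b) =
          (((thetaRay G E up low).galoisLevelData h37.toProp36Hypotheses).tree j).edgeOf b →
        (((thetaRay G E up low).galoisLevelData h37.toProp36Hypotheses).treeAct h37.isCountable j
            (z k)).hom.edgeMap
          ((((thetaRay G E up low).galoisLevelData h37.toProp36Hypotheses).tree j).edgeOf b') =
          (((thetaRay G E up low).galoisLevelData h37.toProp36Hypotheses).tree j).edgeOf b' →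
        (∃ (b₂ : (((thetaRay G E up low).galoisLevelData h37.toProp36Hypotheses).tree j).Branch)
           (v₂ : (((thetaRay G E up low).galoisLevelData h37.toProp36Hypotheses).tree j).Vertex), b₂ ≠ b ∧
          (((thetaRay G E up low).galoisLevelData h37.toProp36Hypotheses).tree j).edgeOf b₂ =
            (((thetaRay G E up low).galoisLevelData h37.toProp36Hypotheses).tree j).edgeOf b ∧
          (((thetaRay G E up low).galoisLevelData h37.toProp36Hypotheses).tree j).abuts b₂ = some v₂ ∧
          (((thetaRay G E up low).galoisLevelData h37.toProp36Hypotheses).treeProj j).vertexMap v₂ =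
            n + 2) →
        (∃ (b₂ : (((thetaRay G E up low).galoisLevelData h37.toProp36Hypotheses).tree j).Branch)
           (v₂ : (((thetaRay G E up low).galoisLevelData h37.toProp36Hypotheses).tree j).Vertex), b₂ ≠ b' ∧
          (((thetaRay G E up low).galoisLevelData h37.toProp36Hypotheses).tree j).edgeOf b₂ =
            (((thetaRay G E up low).galoisLevelData h37.toProp36Hypotheses).tree j).edgeOf b' ∧
          (((thetaRay G E up low).galoisLevelData h37.toProp36Hypotheses).tree j).abuts b₂ = some v₂ ∧
          (((thetaRay G E up low).galoisLevelData h37.toProp36Hypotheses).treeProj j).vertexMap v₂ = n) →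
        False) :
    ¬ CompactInVerticial.{0} := fun h =>
  thetaRay_not_compactInVerticialAt_of_levelEscape h37 z hz hfin hfar hcrit
    (compactInVerticial_iff_forall_at.mp h _)

end ThetaRayEscape

end ProfiniteSemiGraph

end Literature.AnabelianGeometry.SemiGraphs
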